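import Summits.BirchSwinnertonDyer.BirchSwinnertonDyer.Theses.PrintCf2
import Summits.BirchSwinnertonDyer.BirchSwinnertonDyer.Theorems.PrintCf2SplitBadTwoUpperHalfOfFactsRubinRoad
import Summits.BirchSwinnertonDyer.BirchSwinnertonDyer.Theorems.PrintCf2SplitBadTwistCurrency
import HarnessLib

/-!
# Crux `PrintCf2.SplitBadTwoRankOneOfFacts` (stmt-BirchSwinnertonDyer-20368): the ROAD-NEUTRAL socket behind the
# anchors of road α — «the `2`-adic BSD defect is a function of the `2`-adic square class `[d]₂`»

Cell `bsd-print-cf2`, LEAD `bsd-line-cf2-p1` g9 (`--supports stmt-BirchSwinnertonDyer-20368`). THEOREMS ONLY (no definition, no named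
fact, no `sorry`); every published input is an explicit binder. HONEST FRAMING: nothing here proves `BSD₂` for any curve of the class;
BSD is not proved by any of this; no summit statement is proved by this seat.

## The point

Road α (line `rubin_value_two`, parent skeleton of record v5; composition `RubinValueTwo.splitBadTwoRankOneOfFacts_of_laws`, p637992)
closes the crux from S2 (2-adic Rubin value formula, class constant `e_A([d]₂)`), S3 (elliptic-unit control, class constant `e_B([d]₂)`)
and S4 (one certified rank-one `BSD₂` ANCHOR per 2-adic square class `[d]₂`, keyed `(d mod 2, d′ mod 8)`). The only thing the
anchors consume from S2 ∧ S3 is their DIFFERENCE at each member: for every globally minimal `W ≅ 49a1^{(d)}` (`d` squarefree,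
`d ≢ 1 (mod 4)`) of analytic rank one,

  `ord₂ #Ш_an(W) − ord₂ #Ш(W)[2^∞] = e([d]₂)`   for ONE function `e` of the key                                      (DK)

(`#Ш_an` rational — Gross–Zagier I.(7.3) + GZK, named facts, hence the facts-relative antecedents). This file isolates (DK) as the
road-neutral research statement of the class:

* §1 `splitBadTwoRankOneOfFacts_of_defectKey` — PRINTS (bsd.S31 = Creutz–Miller, Modularity (L), Gross–Zagier I.(7.3)) ∧ (DK)
  ∧ S4b (the four kit anchors, verbatim) ⟹ the crux BY NAME: at the anchor of the member's key `BSD(W₀,2)` reads `e([d]₂) = 0`.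
* §2 `defectKey_of_splitBadTwoRankOneOfFacts` — conversely the crux (granted its bundle `𝔅_split`) gives (DK) with `e = 0`: (DK) is
  EXACTLY as strong as the crux modulo the anchors and the prints, i.e. it loses nothing.
* §3 `defectKey_of_laws` — road α's S2 ∧ S3 (with its landed frame supply S1, `RubinValueTwo.stub_katzFrame_two`, p637259) ⟹ (DK)
  with `e = (e_B − e_A)/2`; and `splitBadTwoRankOneOfFacts_of_laws'` re-derives p637992's composition THROUGH the socket (so the
  socket sits on road α, between the two laws and the crux). Any other mechanism proving (DK) — a congruence between the
  `2`-adic BSD quotients of two twists in one class `[d]₂ ∈ ℚ₂ˣ/ℚ₂ˣ²` (idea card `tower-translate-two-mod-eight`), or the twist-field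
  road over `K = ℚ(√d)` where `[d]₂` is exactly the datum `K ⊗ ℚ₂` (p640627 / `…HalvesOverTwistField.lean`) — plugs into §1 unchanged.

The key `(d % 2, (d / (2 − d % 2)) % 8)` and the anchor statement are VERBATIM those of the registered stub `stub_anchor_two_kit`
(skeleton v5 d1eb21d31f9bc683) and of `RubinValueTwo.anchor_two_of_inTree_of_kit` (the two in-tree anchors `d₀ = −1, −2` are
discharged there from bsd.S31 + Modularity). References: [cite: Miller2011LMS, Def. 1.1]; [cite: CreutzMiller2012, Thm. 1.1];
[cite: GrossZagier1986, Thm. I.(7.3)]; [cite: Rubin1992, Cor. 10.2–10.3 (shape of S2/S3)].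
-/

set_option autoImplicit false
-- D-0017 layout: summit = sub-problem, so `Summit.BirchSwinnertonDyer.BirchSwinnertonDyer.…` repeats a path component.
set_option linter.dupNamespace false

noncomputable section

open scoped Classical
open NumberField IsDedekindDomain Field WeierstrassCurve
open Literature.NumberTheory.GaloisRepresentations Literature.NumberTheory.EllipticCurves
open Literature.NumberTheory.EllipticCurves.Rank1Residual
open Literature.NumberTheory.EllipticCurves.DeShalit1987
open Summit.BirchSwinnertonDyer.BirchSwinnertonDyer.Theses.PrintCf2

namespace Summit.BirchSwinnertonDyer.BirchSwinnertonDyer.Theorems.PrintCf2.RubinValueTwo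

/-! ## §1 (DK) ∧ anchors ∧ prints ⟹ the crux BY NAME -/

/-- **The defect-key socket closes the crux.** PRINTS: bsd.S31 (Creutz–Miller, `N < 5000`, rank ≤ 1) and Modularity (L) feed the two
in-tree anchors (`anchor_two_inTree`); Gross–Zagier I.(7.3) and GZK (first conjunct of `𝔅_split`) are the antecedents of the
facts-relative research statement (DK) `hdef`: ONE function `e` of the 2-adic key such that `ord₂ #Ш_an(W) = ord₂ #Ш(W)[2^∞] + e(key)`
for every analytic-rank-one minimal model `W` of `49a1^{(d)}`, `d ≢ 1 (mod 4)`; `h4` = the registered kit-anchor stub S4b verbatim.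
At the anchor `W₀` of the member's key, `BSD(W₀,2)` forces `e(key) = 0`, whence `BSD(W,2)` (rank and finiteness from GZK); class ↔
twists is `splitBadTwoRankOneOfFacts_iff_goldfeld19140` / `GoldfeldGoodTwists.bsdTwoCMSevenAdditiveRankOne_of_twists`.
CONDITIONAL on the displayed binders; nothing about BSD is asserted. [cite: Miller2011LMS, Def. 1.1] [cite: CreutzMiller2012, Thm. 1.1] -/
theorem splitBadTwoRankOneOfFacts_of_defectKey
    (hS31 : bsdTriple_of_rank_le_one_of_conductor_lt) (hnew : ModularForms.exists_isNewformOf)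
    (hGZ : GrossZagier1986_thm_I_7_3)
    (hdef : GrossZagier1986_thm_I_7_3 → rank_eq_analyticRank_of_analyticRank_le_one →
      ∃ e : ℤ → ℤ → ℤ,
      ∀ (d : ℤ), d ≠ 0 → Squarefree d → d % 4 ≠ 1 →
      ∀ (W : WeierstrassCurve ℚ) [W.IsElliptic] [W.IsGloballyMinimal] (C : VariableChange ℚ),
        C • W = cm7.quadraticTwist (d : ℚ) → W.analyticRank = 1 →
      ∃ q : ℚ, shaAn W = (q : ℂ) ∧
        padicValRat 2 q = (padicValNat 2 (Nat.card (AddCommGroup.primaryComponent W.sha 2)) : ℤ)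
          + e (d % 2) ((d / (2 - d % 2)) % 8))
    (h4 : ∀ (d : ℤ), d ≠ 0 → Squarefree d → d % 4 ≠ 1 → (d / (2 - d % 2)) % 8 ≠ 7 →
      ∃ (d₀ : ℤ) (W₀ : WeierstrassCurve ℚ) (_ : W₀.IsElliptic) (_ : W₀.IsGloballyMinimal)
        (C₀ : VariableChange ℚ),
        d₀ ≠ 0 ∧ Squarefree d₀ ∧ d₀ % 4 ≠ 1 ∧ d₀ % 2 = d % 2 ∧ (d₀ / (2 - d₀ % 2)) % 8 = (d / (2 - d % 2)) % 8 ∧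
        C₀ • W₀ = cm7.quadraticTwist (d₀ : ℚ) ∧ W₀.analyticRank = 1 ∧ BSDp W₀ 2) :
    SplitBadTwoRankOneOfFacts := by
  refine Summit.BirchSwinnertonDyer.BirchSwinnertonDyer.Theorems.PrintCf2.splitBadTwoRankOneOfFacts_iff_goldfeld19140.2
    fun hB ↦ ?_
  refine Summit.BirchSwinnertonDyer.BirchSwinnertonDyer.Theorems.GoldfeldGoodTwists.bsdTwoCMSevenAdditiveRankOne_of_twists
    hB.2.2.1 hB.1 hB.2.1 ?_
  intro d hd0 hsq hd4 W _ _ C hC hr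
  have hGZK := hB.1
  obtain ⟨e, he⟩ := hdef hGZ hGZK
  -- the member
  obtain ⟨q, hq, hval⟩ := he d hd0 hsq hd4 W C hC hr
  -- the anchor of the same key
  obtain ⟨d₀, W₀, iE₀, iM₀, C₀, hd₀0, hsq₀, hd₀4, hpar, hmod, hC₀, hr₀, hbsd₀⟩ :=
    anchor_two_of_inTree_of_kit hS31 hnew h4 d hd0 hsq hd4
  obtain ⟨q₀, hq₀, hval₀⟩ := he d₀ hd₀0 hsq₀ hd₀4 W₀ C₀ hC₀ hr₀
  -- `BSD(W₀, 2)` pins the anchor's analytic valuation, hence `e (key) = 0`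
  obtain ⟨-, -, q₀', hq₀', hv₀'⟩ := hbsd₀
  have hqq : q₀' = q₀ := by exact_mod_cast hq₀'.symm.trans hq₀
  subst hqq
  rw [hmod, hpar] at hval₀
  -- conclude `BSD(W, 2)`
  obtain ⟨hrank, hfin⟩ := hGZK W (by rw [hr])
  refine ⟨hrank, ?_, q, hq, ?_⟩
  · haveI := hfin
    infer_instance
  · omega

/-! ## §2 The converse: the crux gives (DK) with `e = 0` -/

/-- **The crux ⟹ (DK) with the zero key-function**, granted the crux's own bundle `𝔅_split` (for the class ↔ twists transport
`bsdp_two_twist_cm7_of_splitBadTwoRankOneOfFacts`; a twist `49a1^{(d)}` with `d ≢ 1 (mod 4)` squarefree is bad at `2`,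
`GoldfeldGoodTwists.not_hasGoodReductionAtPrime_two_of_smul_eq_quadraticTwist`). So (DK) is exactly as strong as the crux modulo
the anchors and the prints. [cite: Miller2011LMS, Def. 1.1] -/
theorem defectKey_of_splitBadTwoRankOneOfFacts (h : SplitBadTwoRankOneOfFacts)
    (hB : rank_eq_analyticRank_of_analyticRank_le_one ∧ hasEntireLFunction_rat ∧
      bsdRHS_eq_of_isIsogenous ∧ bsdTriple_of_hasCM_of_L_one_ne_zero ∧ KrizLi2019.thm112_bsdTwo_twist) :
    ∃ e : ℤ → ℤ → ℤ,
      ∀ (d : ℤ), d ≠ 0 → Squarefree d → d % 4 ≠ 1 →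
      ∀ (W : WeierstrassCurve ℚ) [W.IsElliptic] [W.IsGloballyMinimal] (C : VariableChange ℚ),
        C • W = cm7.quadraticTwist (d : ℚ) → W.analyticRank = 1 →
      ∃ q : ℚ, shaAn W = (q : ℂ) ∧
        padicValRat 2 q = (padicValNat 2 (Nat.card (AddCommGroup.primaryComponent W.sha 2)) : ℤ)
          + e (d % 2) ((d / (2 - d % 2)) % 8) := by
  refine ⟨fun _ _ ↦ 0, ?_⟩
  intro d hd0 hsq hd4 W _ _ C hC hr
  haveI : Fact (Nat.Prime 2) := ⟨Nat.prime_two⟩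
  have hsq4 : ¬ (4 : ℤ) ∣ d := fun h4 ↦ by
    have : (2 * 2 : ℤ) ∣ d := by simpa using h4
    exact absurd (Int.isUnit_iff.mp (hsq 2 this)) (by decide)
  have hg : ¬ W.HasGoodReductionAtPrime 2 :=
    Summit.BirchSwinnertonDyer.BirchSwinnertonDyer.Theorems.GoldfeldGoodTwists.not_hasGoodReductionAtPrime_two_of_smul_eq_quadraticTwist
      cm7 W Summit.BirchSwinnertonDyer.BirchSwinnertonDyer.Theorems.GoldfeldGoodTwists.hasGoodReductionAtPrime_cm7_two
      (d := d) (by omega) hC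
  obtain ⟨-, -, q, hq, hv⟩ :=
    Summit.BirchSwinnertonDyer.BirchSwinnertonDyer.Theorems.GoldfeldGoodTwists.bsdTwo_twists_additive_of_bsdTwoCMSevenAdditiveRankOne
      (Summit.BirchSwinnertonDyer.BirchSwinnertonDyer.Theorems.PrintCf2.splitBadTwoRankOneOfFacts_iff_goldfeld19140.1 h hB)
      hd0 W C hC hg hr
  exact ⟨q, hq, by simpa using hv⟩

/-! ## §3 Road α lands on the socket: S2 ∧ S3 (+ the landed frame supply S1) ⟹ (DK) -/

/-- **S2 ∧ S3 ⟹ (DK)** with `e = (e_B − e_A)/2`: at a member, the Katz frame of `RubinValueTwo.stub_katzFrame_two` (p637259; fed GZK,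
de Shalit II.4.14 and Deuring) carries both laws; the `log`, Tamagawa and torsion terms cancel in their difference, leaving
`2·(ord₂ #Ш_an − ord₂ #Ш[2^∞]) = e_B − e_A`. The binders `h2`, `h3` are VERBATIM those of `splitBadTwoRankOneOfFacts_of_laws`.
[cite: Rubin1992, Cor. 10.2 and Cor. 10.3 (shape)] [cite: deShalit1987, II Thm. 4.14 (p. 71)] -/
theorem defectKey_of_laws
    (hkatz : DeShalit1987.thmII414_exists_katzBranch) (hdeu : Deuring_exists_heckeCharacter_of_maximalCM)
    (hGZK : rank_eq_analyticRank_of_analyticRank_le_one)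
    (h2 : ∃ eA : ℤ → ℤ → ℤ,
      ∀ (d : ℤ), d ≠ 0 → Squarefree d → d % 4 ≠ 1 →
      ∀ (W : WeierstrassCurve ℚ) [W.IsElliptic] [W.IsGloballyMinimal] (C : VariableChange ℚ),
        C • W = cm7.quadraticTwist (d : ℚ) → W.analyticRank = 1 →
      ∀ (K : Type) [Field K] [NumberField K], IsImaginaryQuadratic K →
      ∀ (v vbar : HeightOneSpectrum (𝓞 K)),
        ((2 : ℕ) : 𝓞 K) ∈ v.asIdeal → ((2 : ℕ) : 𝓞 K) ∈ vbar.asIdeal → vbar ≠ v →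
      ∀ (ι : PadicAlgCl 2 ≃+* ℂ),
        (∀ (w : InfinitePlace K) (k : 𝓞 K), k ∈ v.asIdeal ↔ ‖ι.symm (w.embedding (k : K))‖ < 1) →
      ∀ (c : K ≃ₐ[ℚ] K), c ≠ 1 →
      ∀ (ψ : HeckeCharacter K), ψ.HasInfinityType (fun _ ↦ 1) (fun _ ↦ 0) →
        (∀ s : ℂ, 3 / 2 < s.re → heckeLFunction ψ s = W.LSeries s) →
      ∀ (S : Finset (HeightOneSpectrum (𝓞 K))),
        (∀ w : HeightOneSpectrum (𝓞 K), w ∈ S ↔ (¬ ψ.IsUnramifiedAt w ∧ w ≠ v ∧ w ≠ vbar)) →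
      ∀ (κ : ZpExtension K 2) (γ : absoluteGaloisGroup K), κ.IsAnticyclotomic → κ.IsTopGenerator γ →
      ∀ (Ω δ : ℂ) (Ωp : (unrIntegers 2)ˣ) (G : PowerSeries (PadicComplexInt 2)),
        Ω ≠ 0 → (δ ^ 2 = (NumberField.discr K : ℂ) ∨ δ ^ 2 = -(NumberField.discr K : ℂ)) →
        IsKatzBranch ι v vbar S κ γ (HeckeCharacter.galConj c ψ)⁻¹ Ω δ ((Ωp : unrIntegers 2) : ℂ_[2]) G →
      ∀ (P : W.toAffine.Point) (c₀ : ℕ) (ℓ : ℤ),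
        ¬ IsOfFinAddOrder P →
        (∀ R : W.toAffine.Point, ∃ (k : ℤ) (T : W.toAffine.Point), IsOfFinAddOrder T ∧ R = k • P + T) →
        c₀ ≠ 0 → (W.baseChange ℚ_[2]).IsInReductionKernel (c₀ • W.toPadicPoint 2 P) →
        ‖(W.baseChange ℚ_[2]).padicLogPoint (c₀ • W.toPadicPoint 2 P) / (c₀ : ℚ_[2])‖ = (2 : ℝ) ^ (-ℓ) →
      ∃ q : ℚ, shaAn W = (q : ℂ) ∧
        ∀ m : ℤ, ‖((PowerSeries.constantCoeff G : PadicComplexInt 2) : ℂ_[2])‖ = (2 : ℝ) ^ (-(m : ℝ) / 2) →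
          m = 2 * (padicValRat 2 q + (padicValNat 2 W.tamagawaProduct : ℤ)
                - 2 * (padicValNat 2 W.torsionOrder : ℤ) + 2 * ℓ) + eA (d % 2) ((d / (2 - d % 2)) % 8))
    (h3 : ∃ eB : ℤ → ℤ → ℤ,
      ∀ (d : ℤ), d ≠ 0 → Squarefree d → d % 4 ≠ 1 →
      ∀ (W : WeierstrassCurve ℚ) [W.IsElliptic] [W.IsGloballyMinimal] (C : VariableChange ℚ),
        C • W = cm7.quadraticTwist (d : ℚ) → W.analyticRank = 1 →
      ∀ (K : Type) [Field K] [NumberField K], IsImaginaryQuadratic K →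
      ∀ (v vbar : HeightOneSpectrum (𝓞 K)),
        ((2 : ℕ) : 𝓞 K) ∈ v.asIdeal → ((2 : ℕ) : 𝓞 K) ∈ vbar.asIdeal → vbar ≠ v →
      ∀ (ι : PadicAlgCl 2 ≃+* ℂ),
        (∀ (w : InfinitePlace K) (k : 𝓞 K), k ∈ v.asIdeal ↔ ‖ι.symm (w.embedding (k : K))‖ < 1) →
      ∀ (c : K ≃ₐ[ℚ] K), c ≠ 1 →
      ∀ (ψ : HeckeCharacter K), ψ.HasInfinityType (fun _ ↦ 1) (fun _ ↦ 0) →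
        (∀ s : ℂ, 3 / 2 < s.re → heckeLFunction ψ s = W.LSeries s) →
      ∀ (S : Finset (HeightOneSpectrum (𝓞 K))),
        (∀ w : HeightOneSpectrum (𝓞 K), w ∈ S ↔ (¬ ψ.IsUnramifiedAt w ∧ w ≠ v ∧ w ≠ vbar)) →
      ∀ (κ : ZpExtension K 2) (γ : absoluteGaloisGroup K), κ.IsAnticyclotomic → κ.IsTopGenerator γ →
      ∀ (Ω δ : ℂ) (Ωp : (unrIntegers 2)ˣ) (G : PowerSeries (PadicComplexInt 2)),
        Ω ≠ 0 → (δ ^ 2 = (NumberField.discr K : ℂ) ∨ δ ^ 2 = -(NumberField.discr K : ℂ)) →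
        IsKatzBranch ι v vbar S κ γ (HeckeCharacter.galConj c ψ)⁻¹ Ω δ ((Ωp : unrIntegers 2) : ℂ_[2]) G →
      ∀ (P : W.toAffine.Point) (c₀ : ℕ) (ℓ : ℤ),
        ¬ IsOfFinAddOrder P →
        (∀ R : W.toAffine.Point, ∃ (k : ℤ) (T : W.toAffine.Point), IsOfFinAddOrder T ∧ R = k • P + T) →
        c₀ ≠ 0 → (W.baseChange ℚ_[2]).IsInReductionKernel (c₀ • W.toPadicPoint 2 P) →
        ‖(W.baseChange ℚ_[2]).padicLogPoint (c₀ • W.toPadicPoint 2 P) / (c₀ : ℚ_[2])‖ = (2 : ℝ) ^ (-ℓ) →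
      ∃ m : ℤ, ‖((PowerSeries.constantCoeff G : PadicComplexInt 2) : ℂ_[2])‖ = (2 : ℝ) ^ (-(m : ℝ) / 2) ∧
        m = 2 * ((padicValNat 2 (Nat.card (AddCommGroup.primaryComponent W.sha 2)) : ℤ)
              + (padicValNat 2 W.tamagawaProduct : ℤ)
              - 2 * (padicValNat 2 W.torsionOrder : ℤ) + 2 * ℓ) + eB (d % 2) ((d / (2 - d % 2)) % 8)) :
    ∃ e : ℤ → ℤ → ℤ,
      ∀ (d : ℤ), d ≠ 0 → Squarefree d → d % 4 ≠ 1 →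
      ∀ (W : WeierstrassCurve ℚ) [W.IsElliptic] [W.IsGloballyMinimal] (C : VariableChange ℚ),
        C • W = cm7.quadraticTwist (d : ℚ) → W.analyticRank = 1 →
      ∃ q : ℚ, shaAn W = (q : ℂ) ∧
        padicValRat 2 q = (padicValNat 2 (Nat.card (AddCommGroup.primaryComponent W.sha 2)) : ℤ)
          + e (d % 2) ((d / (2 - d % 2)) % 8) := by
  obtain ⟨eA, hA⟩ := h2
  obtain ⟨eB, hBB⟩ := h3
  refine ⟨fun a b ↦ (eB a b - eA a b) / 2, ?_⟩
  intro d hd0 hsq hd4 W _ _ C hC hr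
  obtain ⟨K, iF, iN, v, vbar, ι, cc, ψ, S, κ, γ, Ω, δ, Ωp, G, P, c₀, ℓ, hK, hv, hvbar, hne, hι, hcc, hψ,
    hL, hS, hac, hγ, hΩ, hδ, hG, hP, hgen, hc₀, hker, hlog⟩ := stub_katzFrame_two hGZK hkatz hdeu d hd0 hsq hd4 W C hC hr
  obtain ⟨q, hq, hAq⟩ := hA d hd0 hsq hd4 W C hC hr K hK v vbar hv hvbar hne ι hι cc hcc ψ hψ hL S hS κ γ
    hac hγ Ω δ Ωp G hΩ hδ hG P c₀ ℓ hP hgen hc₀ hker hlog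
  obtain ⟨m, hm, hBm⟩ := hBB d hd0 hsq hd4 W C hC hr K hK v vbar hv hvbar hne ι hι cc hcc ψ hψ hL S hS κ γ
    hac hγ Ω δ Ωp G hΩ hδ hG P c₀ ℓ hP hgen hc₀ hker hlog
  have hAm := hAq m hm
  refine ⟨q, hq, ?_⟩
  dsimp only
  omega

/-- **p637992's composition re-derived THROUGH the socket** (`splitBadTwoRankOneOfFacts_of_defectKey ∘ defectKey_of_laws`): the same
four displayed hypotheses `h0 h2 h3 h4` as `splitBadTwoRankOneOfFacts_of_laws`, plus Gross–Zagier I.(7.3) (`hGZ`, the fifth print of the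
v5 stub `stub_prints_rubin_two`; consumed here only as the antecedent token of the facts-relative (DK)). [cite: Rubin1992, Cor. 10.2 and Cor. 10.3 (shape)] -/
theorem splitBadTwoRankOneOfFacts_of_laws'
    (h0 : DeShalit1987.thmII414_exists_katzBranch ∧ Deuring_exists_heckeCharacter_of_maximalCM ∧
      bsdTriple_of_rank_le_one_of_conductor_lt ∧ ModularForms.exists_isNewformOf)
    (hGZ : GrossZagier1986_thm_I_7_3)
    (h2 : ∃ eA : ℤ → ℤ → ℤ,
      ∀ (d : ℤ), d ≠ 0 → Squarefree d → d % 4 ≠ 1 →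
      ∀ (W : WeierstrassCurve ℚ) [W.IsElliptic] [W.IsGloballyMinimal] (C : VariableChange ℚ),
        C • W = cm7.quadraticTwist (d : ℚ) → W.analyticRank = 1 →
      ∀ (K : Type) [Field K] [NumberField K], IsImaginaryQuadratic K →
      ∀ (v vbar : HeightOneSpectrum (𝓞 K)),
        ((2 : ℕ) : 𝓞 K) ∈ v.asIdeal → ((2 : ℕ) : 𝓞 K) ∈ vbar.asIdeal → vbar ≠ v →
      ∀ (ι : PadicAlgCl 2 ≃+* ℂ),
        (∀ (w : InfinitePlace K) (k : 𝓞 K), k ∈ v.asIdeal ↔ ‖ι.symm (w.embedding (k : K))‖ < 1) →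
      ∀ (c : K ≃ₐ[ℚ] K), c ≠ 1 →
      ∀ (ψ : HeckeCharacter K), ψ.HasInfinityType (fun _ ↦ 1) (fun _ ↦ 0) →
        (∀ s : ℂ, 3 / 2 < s.re → heckeLFunction ψ s = W.LSeries s) →
      ∀ (S : Finset (HeightOneSpectrum (𝓞 K))),
        (∀ w : HeightOneSpectrum (𝓞 K), w ∈ S ↔ (¬ ψ.IsUnramifiedAt w ∧ w ≠ v ∧ w ≠ vbar)) →
      ∀ (κ : ZpExtension K 2) (γ : absoluteGaloisGroup K), κ.IsAnticyclotomic → κ.IsTopGenerator γ →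
      ∀ (Ω δ : ℂ) (Ωp : (unrIntegers 2)ˣ) (G : PowerSeries (PadicComplexInt 2)),
        Ω ≠ 0 → (δ ^ 2 = (NumberField.discr K : ℂ) ∨ δ ^ 2 = -(NumberField.discr K : ℂ)) →
        IsKatzBranch ι v vbar S κ γ (HeckeCharacter.galConj c ψ)⁻¹ Ω δ ((Ωp : unrIntegers 2) : ℂ_[2]) G →
      ∀ (P : W.toAffine.Point) (c₀ : ℕ) (ℓ : ℤ),
        ¬ IsOfFinAddOrder P →
        (∀ R : W.toAffine.Point, ∃ (k : ℤ) (T : W.toAffine.Point), IsOfFinAddOrder T ∧ R = k • P + T) →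
        c₀ ≠ 0 → (W.baseChange ℚ_[2]).IsInReductionKernel (c₀ • W.toPadicPoint 2 P) →
        ‖(W.baseChange ℚ_[2]).padicLogPoint (c₀ • W.toPadicPoint 2 P) / (c₀ : ℚ_[2])‖ = (2 : ℝ) ^ (-ℓ) →
      ∃ q : ℚ, shaAn W = (q : ℂ) ∧
        ∀ m : ℤ, ‖((PowerSeries.constantCoeff G : PadicComplexInt 2) : ℂ_[2])‖ = (2 : ℝ) ^ (-(m : ℝ) / 2) →
          m = 2 * (padicValRat 2 q + (padicValNat 2 W.tamagawaProduct : ℤ)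
                - 2 * (padicValNat 2 W.torsionOrder : ℤ) + 2 * ℓ) + eA (d % 2) ((d / (2 - d % 2)) % 8))
    (h3 : ∃ eB : ℤ → ℤ → ℤ,
      ∀ (d : ℤ), d ≠ 0 → Squarefree d → d % 4 ≠ 1 →
      ∀ (W : WeierstrassCurve ℚ) [W.IsElliptic] [W.IsGloballyMinimal] (C : VariableChange ℚ),
        C • W = cm7.quadraticTwist (d : ℚ) → W.analyticRank = 1 →
      ∀ (K : Type) [Field K] [NumberField K], IsImaginaryQuadratic K →
      ∀ (v vbar : HeightOneSpectrum (𝓞 K)),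
        ((2 : ℕ) : 𝓞 K) ∈ v.asIdeal → ((2 : ℕ) : 𝓞 K) ∈ vbar.asIdeal → vbar ≠ v →
      ∀ (ι : PadicAlgCl 2 ≃+* ℂ),
        (∀ (w : InfinitePlace K) (k : 𝓞 K), k ∈ v.asIdeal ↔ ‖ι.symm (w.embedding (k : K))‖ < 1) →
      ∀ (c : K ≃ₐ[ℚ] K), c ≠ 1 →
      ∀ (ψ : HeckeCharacter K), ψ.HasInfinityType (fun _ ↦ 1) (fun _ ↦ 0) →
        (∀ s : ℂ, 3 / 2 < s.re → heckeLFunction ψ s = W.LSeries s) →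
      ∀ (S : Finset (HeightOneSpectrum (𝓞 K))),
        (∀ w : HeightOneSpectrum (𝓞 K), w ∈ S ↔ (¬ ψ.IsUnramifiedAt w ∧ w ≠ v ∧ w ≠ vbar)) →
      ∀ (κ : ZpExtension K 2) (γ : absoluteGaloisGroup K), κ.IsAnticyclotomic → κ.IsTopGenerator γ →
      ∀ (Ω δ : ℂ) (Ωp : (unrIntegers 2)ˣ) (G : PowerSeries (PadicComplexInt 2)),
        Ω ≠ 0 → (δ ^ 2 = (NumberField.discr K : ℂ) ∨ δ ^ 2 = -(NumberField.discr K : ℂ)) →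
        IsKatzBranch ι v vbar S κ γ (HeckeCharacter.galConj c ψ)⁻¹ Ω δ ((Ωp : unrIntegers 2) : ℂ_[2]) G →
      ∀ (P : W.toAffine.Point) (c₀ : ℕ) (ℓ : ℤ),
        ¬ IsOfFinAddOrder P →
        (∀ R : W.toAffine.Point, ∃ (k : ℤ) (T : W.toAffine.Point), IsOfFinAddOrder T ∧ R = k • P + T) →
        c₀ ≠ 0 → (W.baseChange ℚ_[2]).IsInReductionKernel (c₀ • W.toPadicPoint 2 P) →
        ‖(W.baseChange ℚ_[2]).padicLogPoint (c₀ • W.toPadicPoint 2 P) / (c₀ : ℚ_[2])‖ = (2 : ℝ) ^ (-ℓ) →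
      ∃ m : ℤ, ‖((PowerSeries.constantCoeff G : PadicComplexInt 2) : ℂ_[2])‖ = (2 : ℝ) ^ (-(m : ℝ) / 2) ∧
        m = 2 * ((padicValNat 2 (Nat.card (AddCommGroup.primaryComponent W.sha 2)) : ℤ)
              + (padicValNat 2 W.tamagawaProduct : ℤ)
              - 2 * (padicValNat 2 W.torsionOrder : ℤ) + 2 * ℓ) + eB (d % 2) ((d / (2 - d % 2)) % 8))
    (h4 : ∀ (d : ℤ), d ≠ 0 → Squarefree d → d % 4 ≠ 1 → (d / (2 - d % 2)) % 8 ≠ 7 →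
      ∃ (d₀ : ℤ) (W₀ : WeierstrassCurve ℚ) (_ : W₀.IsElliptic) (_ : W₀.IsGloballyMinimal)
        (C₀ : VariableChange ℚ),
        d₀ ≠ 0 ∧ Squarefree d₀ ∧ d₀ % 4 ≠ 1 ∧ d₀ % 2 = d % 2 ∧ (d₀ / (2 - d₀ % 2)) % 8 = (d / (2 - d % 2)) % 8 ∧
        C₀ • W₀ = cm7.quadraticTwist (d₀ : ℚ) ∧ W₀.analyticRank = 1 ∧ BSDp W₀ 2) :
    SplitBadTwoRankOneOfFacts :=
  splitBadTwoRankOneOfFacts_of_defectKey h0.2.2.1 h0.2.2.2 hGZ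
    (fun _ hGZK ↦ defectKey_of_laws h0.1 h0.2.1 hGZK h2 h3) h4

end Summit.BirchSwinnertonDyer.BirchSwinnertonDyer.Theorems.PrintCf2.RubinValueTwo

end
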